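import Mathlib
import Summits.Ventures.DiscreteObjects.Mahler.BlaschkeData

/-!
# Blaschke data with conjugation symmetry (venture `DiscreteObjects`, target L)

Cell `pub-namedobj`, seat `pub-namedobj-mahler` (gen 8). Framing: lottery ticket; floor = certified
bounds/negative ranges.

For Smyth's theorem ([McKee–Smyth, *Around the Unit Circle*, §12.2]) the Blaschke quotients `f, g` of a
monic integer polynomial must have REAL Taylor coefficients.  We re-run gen 7's construction
(`BlaschkeData.exists_blaschke_data`) recording in addition the symmetry `f (z̄) = conj (f z)`,
`g (z̄) = conj (g z)` (`exists_blaschke_data_symm`), which holds because the multiset of complex roots of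
an integer polynomial is closed under conjugation (`conj_multiset_prod_sub`,
`conj_multiset_prod_one_sub_conj_mul`).
-/

namespace Summit.Ventures.DiscreteObjects.Mahler

open Polynomial Complex Metric Set Filter Topology
open scoped ComplexConjugate

/-- Conjugating a product `∏ (w - α)` over a conjugation-closed multiset. -/
theorem conj_multiset_prod_sub {T : Multiset ℂ} (hT : T.map (starRingEnd ℂ) = T) (w : ℂ) :
    starRingEnd ℂ ((T.map fun α => w - α).prod) = (T.map fun α => starRingEnd ℂ w - α).prod := by
  rw [map_multiset_prod, Multiset.map_map]
  conv_rhs => rw [← hT, Multiset.map_map]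
  congr 1
  apply Multiset.map_congr rfl
  intro α _
  simp [map_sub]

/-- Conjugating a product `∏ (1 - ᾱ w)` over a conjugation-closed multiset. -/
theorem conj_multiset_prod_one_sub_conj_mul {T : Multiset ℂ} (hT : T.map (starRingEnd ℂ) = T) (w : ℂ) :
    starRingEnd ℂ ((T.map fun α => 1 - starRingEnd ℂ α * w).prod) =
      (T.map fun α => 1 - starRingEnd ℂ α * starRingEnd ℂ w).prod := by
  rw [map_multiset_prod, Multiset.map_map]
  conv_rhs => rw [← hT, Multiset.map_map]
  congr 1
  apply Multiset.map_congr rfl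
  intro α _
  simp [map_sub, map_mul]

/-- **Blaschke data with conjugation symmetry.**  For `P` monic with `P(0) = ε`, `ε² = 1`, there are
`f, g` holomorphic on the unit disc, bounded by `1` there, with `f · P* = ε · P · g` on the disc,
`‖g 0‖ = 1/M(P)`, `f 0 = g 0`, and the symmetry `f (conj z) = conj (f z)`, `g (conj z) = conj (g z)`
(so all Taylor coefficients of `f` and `g` are real).  Same construction as gen 7's
`exists_blaschke_data` (`f = ε ∏_{‖α‖≤1} (z-α)/(1-ᾱz)`, `g = ∏_{‖α‖>1} (1-ᾱz)/(z-α)` over the complex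
roots of `P`, a multiset closed under conjugation). -/
theorem exists_blaschke_data_symm {P : ℤ[X]} (hmonic : P.Monic) {ε : ℤ} (hε : P.coeff 0 = ε)
    (hε1 : ε * ε = 1) :
    ∃ f g : ℂ → ℂ, DifferentiableOn ℂ f (ball 0 1) ∧ DifferentiableOn ℂ g (ball 0 1) ∧
      (∀ z ∈ ball (0 : ℂ) 1, ‖f z‖ ≤ 1) ∧ (∀ z ∈ ball (0 : ℂ) 1, ‖g z‖ ≤ 1) ∧
      (∀ z ∈ ball (0 : ℂ) 1, f z * (P.reverse.map (Int.castRingHom ℂ)).eval z =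
        (ε : ℂ) * (P.map (Int.castRingHom ℂ)).eval z * g z) ∧
      ‖g 0‖ = (intMahlerMeasure P)⁻¹ ∧ f 0 = g 0 ∧
      (∀ z, f (starRingEnd ℂ z) = starRingEnd ℂ (f z)) ∧
      (∀ z, g (starRingEnd ℂ z) = starRingEnd ℂ (g z)) := by
  classical
  set Pc := P.map (Int.castRingHom ℂ) with hPc
  have hPcm : Pc.Monic := hmonic.map _
  set S := Pc.roots with hSdef
  have hcard : Multiset.card S = Pc.natDegree := IsAlgClosed.card_roots_eq_natDegree
  have hprod : (S.map fun α => X - C α).prod = Pc :=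
    prod_multiset_X_sub_C_of_monic_of_roots_card_eq hPcm hcard
  set S₁ := S.filter fun α => ‖α‖ ≤ 1 with hS₁
  set S₂ := S.filter fun α => ¬ ‖α‖ ≤ 1 with hS₂
  have hS : S₁ + S₂ = S := Multiset.filter_add_not _ S
  have hS₁conj : S₁.map (starRingEnd ℂ) = S₁ :=
    filter_roots_map_conj P _ (fun α => by rw [Complex.norm_conj])
  have hS₂conj : S₂.map (starRingEnd ℂ) = S₂ :=
    filter_roots_map_conj P _ (fun α => by rw [Complex.norm_conj])
  have hmem₁ : ∀ α ∈ S₁, ‖α‖ ≤ 1 := fun α hα => (Multiset.mem_filter.mp hα).2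
  have hmem₂ : ∀ α ∈ S₂, 1 ≤ ‖α‖ := fun α hα => (not_le.mp (Multiset.mem_filter.mp hα).2).le
  have hmem₂' : ∀ α ∈ S₂, 1 < ‖α‖ := fun α hα => not_le.mp (Multiset.mem_filter.mp hα).2
  -- the four polynomials
  set A : ℂ[X] := (S₁.map fun α => X - C α).prod with hA
  set B : ℂ[X] := (S₂.map fun α => X - C α).prod with hB
  set Abar : ℂ[X] := (S₁.map fun α => (1 : ℂ[X]) - C (starRingEnd ℂ α) * X).prod with hAbar
  set Bbar : ℂ[X] := (S₂.map fun α => (1 : ℂ[X]) - C (starRingEnd ℂ α) * X).prod with hBbar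
  have hPAB : Pc = A * B := by
    rw [← hprod, ← hS, Multiset.map_add, Multiset.prod_add]
  have hconj_prod : ∀ T : Multiset ℂ, T.map (starRingEnd ℂ) = T →
      (T.map fun α => (1 : ℂ[X]) - C (starRingEnd ℂ α) * X).prod =
        (T.map fun α => (1 : ℂ[X]) - C α * X).prod := by
    intro T hT
    conv_rhs => rw [← hT, Multiset.map_map]
    rfl
  have hPrev : Pc.reverse = Abar * Bbar := by
    rw [← hprod, reverse_multiset_prod_X_sub_C, ← hS, Multiset.map_add, Multiset.prod_add,
      ← hconj_prod S₁ hS₁conj, ← hconj_prod S₂ hS₂conj]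
  have hPrev' : P.reverse.map (Int.castRingHom ℂ) = Abar * Bbar := by
    rw [← reverse_map_intCast, ← hPc, hPrev]
  -- evaluations
  have hAe : ∀ z, A.eval z = (S₁.map fun α => z - α).prod := fun z => eval_multiset_prod_X_sub_C S₁ z
  have hBe : ∀ z, B.eval z = (S₂.map fun α => z - α).prod := fun z => eval_multiset_prod_X_sub_C S₂ z
  have hAbe : ∀ z, Abar.eval z = (S₁.map fun α => 1 - starRingEnd ℂ α * z).prod := fun z =>
    eval_multiset_prod_one_sub_C_mul_X S₁ _ z
  have hBbe : ∀ z, Bbar.eval z = (S₂.map fun α => 1 - starRingEnd ℂ α * z).prod := fun z =>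
    eval_multiset_prod_one_sub_C_mul_X S₂ _ z
  -- nonvanishing on the disc
  have hAbar0 : ∀ z ∈ ball (0 : ℂ) 1, Abar.eval z ≠ 0 := by
    intro z hz
    rw [hAbe]
    apply multiset_prod_ne_zero
    intro α hα h0
    have h1 : starRingEnd ℂ α * z = 1 := (sub_eq_zero.mp h0).symm
    have h2 : ‖starRingEnd ℂ α * z‖ < 1 := by
      rw [norm_mul, Complex.norm_conj]
      have := hmem₁ α hα
      have hz' := mem_ball_zero_iff.mp hz
      calc ‖α‖ * ‖z‖ ≤ 1 * ‖z‖ := by gcongr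
        _ < 1 := by rw [one_mul]; exact hz'
    rw [h1, norm_one] at h2
    exact lt_irrefl _ h2
  have hB0 : ∀ z ∈ ball (0 : ℂ) 1, B.eval z ≠ 0 := by
    intro z hz
    rw [hBe]
    apply multiset_prod_ne_zero
    intro α hα h0
    have h1 : z = α := sub_eq_zero.mp h0
    have := hmem₂' α hα
    rw [← h1] at this
    exact absurd (mem_ball_zero_iff.mp hz) (not_lt.mpr this.le)
  -- the functions
  refine ⟨fun z => (ε : ℂ) * A.eval z / Abar.eval z, fun z => Bbar.eval z / B.eval z,
    ?_, ?_, ?_, ?_, ?_, ?_, ?_, ?_, ?_⟩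
  · -- differentiability of f
    apply DifferentiableOn.div _ _ hAbar0
    · exact ((Polynomial.differentiable A).const_mul _).differentiableOn
    · exact (Polynomial.differentiable Abar).differentiableOn
  · apply DifferentiableOn.div _ _ hB0
    · exact (Polynomial.differentiable Bbar).differentiableOn
    · exact (Polynomial.differentiable B).differentiableOn
  · -- bound for f
    intro z hz
    have hz' : ‖z‖ ≤ 1 := (mem_ball_zero_iff.mp hz).le
    have hεn : ‖(ε : ℂ)‖ = 1 := by
      have : ((ε : ℂ)) * (ε : ℂ) = 1 := by exact_mod_cast hε1
      have h := congrArg norm this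
      rw [norm_mul, norm_one] at h
      nlinarith [norm_nonneg (ε : ℂ)]
    rw [norm_div, norm_mul, hεn, one_mul]
    apply div_le_one_of_le₀ _ (norm_nonneg _)
    rw [hAe, hAbe]
    exact norm_multiset_prod_le fun α hα => norm_sub_le_norm_one_sub_conj_mul (hmem₁ α hα) hz'
  · -- bound for g
    intro z hz
    have hz' : ‖z‖ ≤ 1 := (mem_ball_zero_iff.mp hz).le
    rw [norm_div]
    apply div_le_one_of_le₀ _ (norm_nonneg _)
    rw [hBe, hBbe]
    exact norm_multiset_prod_le fun α hα => norm_one_sub_conj_mul_le_norm_sub (hmem₂ α hα) hz'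
  · -- the identity f · P* = ε P g
    intro z hz
    simp only
    rw [hPrev', hPAB, eval_mul, eval_mul]
    field_simp [hAbar0 z hz, hB0 z hz]
  · -- ‖g 0‖ = 1/M
    have hB0e : ‖B.eval 0‖ = (S₂.map fun α => ‖α‖).prod := by
      rw [hBe, norm_multiset_prod_eq]
      congr 1
      apply Multiset.map_congr rfl
      intro α _; simp
    have hBb0e : Bbar.eval 0 = 1 := by
      rw [hBbe]; simp
    have hM : intMahlerMeasure P = (S₂.map fun α => ‖α‖).prod := by
      unfold intMahlerMeasure
      rw [← hPc, mahlerMeasure_eq_leadingCoeff_mul_prod_roots, hPcm.leadingCoeff, norm_one, one_mul,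
        ← hSdef, ← hS, Multiset.map_add, Multiset.prod_add]
      have h1 : (S₁.map fun α => max 1 ‖α‖).prod = 1 := by
        apply Multiset.prod_eq_one
        intro x hx
        obtain ⟨α, hα, rfl⟩ := Multiset.mem_map.mp hx
        exact max_eq_left (hmem₁ α hα)
      have h2 : (S₂.map fun α => max 1 ‖α‖) = S₂.map fun α => ‖α‖ := by
        apply Multiset.map_congr rfl
        intro α hα
        exact max_eq_right (hmem₂ α hα)
      rw [h1, h2, one_mul]
    simp only
    rw [norm_div, hBb0e, norm_one, hB0e, hM, one_div]
  · -- f 0 = g 0, from the identity at 0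
    have hPc0 : Pc.eval 0 = (ε : ℂ) := by
      rw [← coeff_zero_eq_eval_zero, hPc, coeff_map, hε]; simp
    have hPr0 : (P.reverse.map (Int.castRingHom ℂ)).eval 0 = 1 := by
      rw [← coeff_zero_eq_eval_zero, coeff_map, coeff_zero_reverse, hmonic.leadingCoeff]; simp
    have hεε : ((ε : ℂ)) * (ε : ℂ) = 1 := by exact_mod_cast hε1
    have hAbar00 : Abar.eval 0 ≠ 0 := hAbar0 0 (mem_ball_self one_pos)
    have hB00 : B.eval 0 ≠ 0 := hB0 0 (mem_ball_self one_pos)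
    have hid : (ε : ℂ) * A.eval 0 / Abar.eval 0 * (P.reverse.map (Int.castRingHom ℂ)).eval 0 =
        (ε : ℂ) * Pc.eval 0 * (Bbar.eval 0 / B.eval 0) := by
      rw [hPrev', hPAB, eval_mul, eval_mul]
      field_simp
    rw [hPr0, mul_one, hPc0] at hid
    simp only
    rw [hid, hεε, one_mul]
  · -- conjugation symmetry of f
    intro z
    simp only
    rw [map_div₀, map_mul, map_intCast, hAe, hAe, hAbe, hAbe,
      conj_multiset_prod_sub hS₁conj, conj_multiset_prod_one_sub_conj_mul hS₁conj]
  · -- conjugation symmetry of g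
    intro z
    simp only
    rw [map_div₀, hBe, hBe, hBbe, hBbe, conj_multiset_prod_sub hS₂conj,
      conj_multiset_prod_one_sub_conj_mul hS₂conj]


end Summit.Ventures.DiscreteObjects.Mahler
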